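import Summits.CriticalPhenomena.PercolationContinuityZ3.Theorems.PercNearOneGluingNoHeavyLowerTailHubPairTermCells
import Summits.CriticalPhenomena.PercolationContinuityZ3.Theorems.PercNearOneGluingNoHeavyLowerTailThetaFarRows
import HarnessLib

/-!
# `NoHeavyLowerTail` (stmt-CriticalPhenomena-4575) — HUB PAIRS WITH A TERMINAL ALONE ON ITS SIDE, part 4:
# the 2|1 identity in intrinsic variables and the near-side / arm bookkeeping (every `q > 0`)

Support file (prover prim-gen-kcluster gen 72; `--supports stmt-CriticalPhenomena-4575`).  No definitions, no named facts, no sorries.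
This is KCLUSTER-gen65 §11 (`Split21.split21_identity`, p-landed as `…Split21Blocks`) at the MEASURE LEVEL and with the near side ARBITRARY: the
k-state dictionary of gen 65 is replaced by the eight-state dictionary of parts 2–3, whose near-side functionals are intrinsic events, and the 2|1
identity is re-proved in these variables (`split21_pos`: it holds given seven linear relations between the event masses, all pointwise).

SETTING.  `V` finite; apex `a`, terminals `b, c`, hubs `h₀ ≠ h₁`; supports `DX` (the arm of `c`: `c ∈ V(DX)`, `c` reaches both hubs inside `DX`;
`a, b ∉ V(DX)`) and `DK` (the near side, `c ∉ V(DK)`), meeting only in `{h₀, h₁}`; `D = DX ∪ DK`; weights `w` on `DX ∪ DK`, `wX = w·1_{DX}`,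
`wK = w·1_{DXᶜ}`; `φ = rcMeasureW w q ∅`, `φ_X`, `φ_K = rcMeasureW wK q ∅` and the hub-wired `φ_K^w = rcMeasureW wK q {h₀,h₁}` (its events are read
after inserting the pair `h₀h₁`).  Near-side atoms: `B = [b ∈ C(a)]`, `H_i = [h_i ∈ C(a)]`, `S_i = Sep DK C(a) b h_i`.
HYPOTHESES.  Arm: R1 for `(h₀; c, h₁)` and `(h₁; c, h₀)`, FKG slack for `(h₀; c, h₁)` (automatic for `q ≥ 1`), `φ_X(c, h₁ ∈ C(h₀)) ≠ 0`.
Near side (gen 65 §11, Corollary C): R1 for `(a; b, h₀)`, `(a; b, h₁)` on `φ_K`, R1 for `(a; b, h)` on `φ_K^w`; the HUB-CROSS rows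
`HC1_h : Sb_h·T^w + S^w·T_h ≤ Uc'_h·Ub'^w + Uc'^w·Ub'_h` (`h = h₀, h₁`), `HC2 : Sm·T^w ≤ Uc'^w·Um`, `HC3 : Sb₀T₁ + Sb₁T₀ ≤ Uc'₀Ub'₁ + Uc'₁Ub'₀`, where
`T_h = {B∧H_h}`, `Ub'_h = {B∧¬H_h}`, `Uc'_h = {¬B∧H_h}`, `Sb₀ = {¬B∧¬H₀∧S₀∧(H₁∨S₁)}`, `Um = {B}`, `Sm = {¬B∧(H₀∨S₀)∧(H₁∨S₁)}`, and `T^w, Ub'^w, Uc'^w,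
S^w = {¬B∧¬H₀∧S₀∧S₁}` read on `φ_K^w`.
**THEOREM** (`HubPairTerm.r1_of_near_side`): then R1 holds for `(a; b, c)` on `φ` with support `D`.  Hence (gen 65 Corollary C, now kernel modulo
landing): a minimal counterexample to R1-RC(q ≥ 1) has no terminal-isolating hub pair UNLESS one of the hub-cross rows HC1–HC3 fails on the near side.
-/

noncomputable section

namespace Summit.CriticalPhenomena.PercolationContinuityZ3.Theorems

namespace HubPairTerm

open Finset SimpleGraph Literature.Probability.Percolation Literature.Probability.Percolation.Gladkov
open Literature.Probability.Percolation.BHK2006 (weight)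
open Literature.Probability.Percolation.DecisionTree (ind ind_of_mem ind_of_not_mem ind_nonneg)
open Literature.Probability.LatticeModels RefinedRowR3 ThreePointLB APL MeasureTheory
open scoped Classical

variable {V : Type*} [Fintype V]

/-! ### The 2|1 identity in intrinsic variables -/

omit [Fintype V] in
set_option maxHeartbeats 1600000 in
/-- **The 2|1 split inequality** (gen 65 §11's identity in the eight-state variables; pure algebra). [this work] -/
theorem split21_pos
    {XA XB XC XD XE XF XG XH q Tw Ucw Ubw Sw T0 Uc0 Ub0 Sb0 S0 T1 Uc1 Ub1 Sb1 S1 Um Sm RF RG RH RBUb RBS : ℝ}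
    {ZTB ZTE ZTF ZTG ZTH ZcB ZcE ZcF ZcG ZcH : ℝ}
    (hZTB : ZTB = 0) (hZTE : ZTE = 0) (hZTF : ZTF = 0) (hZTG : ZTG = 0) (hZTH : ZTH = 0)
    (hZcB : ZcB = 0) (hZcE : ZcE = 0) (hZcF : ZcF = 0) (hZcG : ZcG = 0) (hZcH : ZcH = 0)
    (hq : 0 < q) (pXA : 0 < XA) (hXB : 0 ≤ XB) (hXC : 0 ≤ XC) (hXD : 0 ≤ XD)
    (hTw : 0 ≤ Tw) (hT0 : 0 ≤ T0) (hT1 : 0 ≤ T1)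
    (eUm : Um = T0 + Uc0) (eUm1 : Um = T1 + Uc1) (eRBUb : RBUb = Tw + Ucw) (eRBS : RBS = Sw + Ubw)
    (eRF : RF = Sb0 + Ub0) (eRG : RG = Sb1 + Ub1) (eRH : RH = RF + RG - Sm)
    (hD0 : Sb0 ≤ S0) (hD1 : Sb1 ≤ S1) (hJ0 : Sm ≤ RF) (hJ1 : Sm ≤ RG)
    (hr1w : Tw * Sw ≤ Ucw * Ubw) (hr10 : T0 * S0 ≤ Uc0 * Ub0) (hr11 : T1 * S1 ≤ Uc1 * Ub1)
    (hhc10 : Sb0 * Tw + Sw * T0 ≤ Ub0 * Ucw + Ubw * Uc0) (hhc11 : Sb1 * Tw + Sw * T1 ≤ Ub1 * Ucw + Ubw * Uc1)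
    (hhc2 : Sm * Tw ≤ Ubw * Um) (hhc3 : Sb0 * T1 + Sb1 * T0 ≤ Ub0 * Uc1 + Ub1 * Uc0)
    (XEt XN XM : ℝ) (eXEt : XEt = XE + XF + XG + XH) (eXN : XN = XF + XH) (eXM : XM = XG + XH)
    (hφ : 0 ≤ XA * (q * XEt) - XB * (q * XC + q * XD)) (hρ : 0 ≤ XB * (q * XC) - XA * (q * XN)) (hσ : 0 ≤ XB * (q * XD) - XA * (q * XM)) :
    (XA * Tw + XB * ZTB + XC * T0 + XD * T1 + XE * ZTE + XF * ZTF + XG * ZTG + XH * ZTH) * (XA * Sw + XB * RBS + XC * Sb0 + XD * Sb1 + XE * Sm + XF * RF + XG * RG + XH * RH) ≤ (XA * Ucw + XB * RBUb + XC * Uc0 + XD * Uc1 + XE * Um + XF * Um + XG * Um + XH * Um) * (XA * Ubw + XB * ZcB + XC * Ub0 + XD * Ub1 + XE * ZcE + XF * ZcF + XG * ZcG + XH * ZcH) := by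
  subst hZTB hZTE hZTF hZTG hZTH hZcB hZcE hZcF hZcG hZcH
  have eUc1 : Uc1 = Um - T1 := by linarith
  have hφm : 0 ≤ XA * (XE + XF + XG + XH) - XB * (XC + XD) := by
    refine (mul_nonneg_iff_of_pos_left hq).1 ?_
    rw [show q * (XA * (XE + XF + XG + XH) - XB * (XC + XD)) = XA * (q * XEt) - XB * (q * XC + q * XD) by subst eXEt; ring]
    exact hφ
  have hρm : 0 ≤ XB * XC - XA * (XF + XH) := by
    refine (mul_nonneg_iff_of_pos_left hq).1 ?_
    rw [show q * (XB * XC - XA * (XF + XH)) = XB * (q * XC) - XA * (q * XN) by subst eXN; ring]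
    exact hρ
  have hσm : 0 ≤ XB * XD - XA * (XG + XH) := by
    refine (mul_nonneg_iff_of_pos_left hq).1 ?_
    rw [show q * (XB * XD - XA * (XG + XH)) = XB * (q * XD) - XA * (q * XM) by subst eXM; ring]
    exact hσ
  -- name the non-negative forms
  obtain ⟨r1w, er1w, hr1w'⟩ : ∃ r : ℝ, r = Ubw * Ucw - Sw * Tw ∧ 0 ≤ r := ⟨_, rfl, by linarith⟩
  obtain ⟨r10, er10, hr10'⟩ : ∃ r : ℝ, r = Ub0 * Uc0 - S0 * T0 ∧ 0 ≤ r := ⟨_, rfl, by linarith⟩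
  obtain ⟨r11, er11, hr11'⟩ : ∃ r : ℝ, r = Ub1 * Uc1 - S1 * T1 ∧ 0 ≤ r := ⟨_, rfl, by linarith⟩
  obtain ⟨hc10, ehc10, hhc10'⟩ : ∃ r : ℝ, r = -Sb0 * Tw - Sw * T0 + Ub0 * Ucw + Ubw * Uc0 ∧ 0 ≤ r := ⟨_, rfl, by linarith⟩
  obtain ⟨hc11, ehc11, hhc11'⟩ : ∃ r : ℝ, r = -Sb1 * Tw - Sw * T1 + Ub1 * Ucw + Ubw * Uc1 ∧ 0 ≤ r := ⟨_, rfl, by linarith⟩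
  obtain ⟨hc2, ehc2, hhc2'⟩ : ∃ r : ℝ, r = -Sm * Tw + Ubw * Um ∧ 0 ≤ r := ⟨_, rfl, by linarith⟩
  obtain ⟨hc3, ehc3, hhc3'⟩ : ∃ r : ℝ, r = -Sb0 * T1 - Sb1 * T0 + Ub0 * Uc1 + Ub1 * Uc0 ∧ 0 ≤ r := ⟨_, rfl, by linarith⟩
  obtain ⟨D0, eD0, hD0'⟩ : ∃ r : ℝ, r = S0 - Sb0 ∧ 0 ≤ r := ⟨_, rfl, sub_nonneg.2 hD0⟩
  obtain ⟨D1, eD1, hD1'⟩ : ∃ r : ℝ, r = S1 - Sb1 ∧ 0 ≤ r := ⟨_, rfl, sub_nonneg.2 hD1⟩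
  obtain ⟨J0, eJ0, hJ0'⟩ : ∃ r : ℝ, r = RF - Sm ∧ 0 ≤ r := ⟨_, rfl, sub_nonneg.2 hJ0⟩
  obtain ⟨J1, eJ1, hJ1'⟩ : ∃ r : ℝ, r = RG - Sm ∧ 0 ≤ r := ⟨_, rfl, sub_nonneg.2 hJ1⟩
  obtain ⟨φ, eφ, hφ'⟩ : ∃ r : ℝ, r = XA * (XE + XF + XG + XH) - XB * (XC + XD) ∧ 0 ≤ r := ⟨_, rfl, hφm⟩
  obtain ⟨ρ, eρ, hρ'⟩ : ∃ r : ℝ, r = XB * XC - XA * (XF + XH) ∧ 0 ≤ r := ⟨_, rfl, hρm⟩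
  obtain ⟨σ, eσ, hσ'⟩ : ∃ r : ℝ, r = XB * XD - XA * (XG + XH) ∧ 0 ≤ r := ⟨_, rfl, hσm⟩
  have hXA := pXA.le
  have hG : 0 ≤ (XA + XB) * (XA ^ 2 * (q ^ 2 * r1w) + XA * (q * XC) * (q * hc10) + XA * (q * XD) * (q * hc11) + (q * XC) ^ 2 * (r10 + T0 * D0) +
          (q * XC) * (q * XD) * hc3 + (q * XD) ^ 2 * (r11 + T1 * D1)) +
        (q * φ) * (XA * (q * hc2) + (q * XC) * (r10 + T0 * (D0 + J0)) + (q * XD) * (r11 + T1 * (D1 + J1))) +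
        ((q * ρ) * J0 + (q * σ) * J1) * (XA * (q * Tw) + (q * XC) * T0 + (q * XD) * T1) := by positivity
  have key : XA * q ^ 2 * ((XA * Ucw + XB * RBUb + XC * Uc0 + XD * Uc1 + XE * Um + XF * Um + XG * Um + XH * Um) * (XA * Ubw + XB * 0 + XC * Ub0 + XD * Ub1 + XE * 0 + XF * 0 + XG * 0 + XH * 0)) - XA * q ^ 2 * ((XA * Tw + XB * 0 + XC * T0 + XD * T1 + XE * 0 + XF * 0 + XG * 0 + XH * 0) * (XA * Sw + XB * RBS + XC * Sb0 + XD * Sb1 + XE * Sm + XF * RF + XG * RG + XH * RH)) =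
      (XA + XB) * (XA ^ 2 * (q ^ 2 * r1w) + XA * (q * XC) * (q * hc10) + XA * (q * XD) * (q * hc11) + (q * XC) ^ 2 * (r10 + T0 * D0) +
          (q * XC) * (q * XD) * hc3 + (q * XD) ^ 2 * (r11 + T1 * D1)) +
        (q * φ) * (XA * (q * hc2) + (q * XC) * (r10 + T0 * (D0 + J0)) + (q * XD) * (r11 + T1 * (D1 + J1))) +
        ((q * ρ) * J0 + (q * σ) * J1) * (XA * (q * Tw) + (q * XC) * T0 + (q * XD) * T1) := by
    clear hφ hρ hσ eXEt eXN eXM hr1w hr10 hr11 hhc10 hhc11 hhc2 hhc3 eUm1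
    subst er1w er10 er11 ehc10 ehc11 ehc2 ehc3 eD0 eD1 eJ0 eJ1 eφ eρ eσ eUc1 eRBUb eRBS eRH eUm eRF eRG
    ring
  have hpos : 0 < XA * q ^ 2 := by positivity
  refine le_of_mul_le_mul_left ?_ hpos
  linarith [key, hG]

section Main

variable {DX DK D : Finset (Sym2 V)} {a b c h₀ h₁ : V} (h01 : h₀ ≠ h₁) (hb0 : b ≠ h₀) (hb1 : b ≠ h₁) (hc0 : c ≠ h₀) (hc1 : c ≠ h₁)
  (hbc : b ≠ c) (hca : c ≠ a)
  (hsepD : ∀ t : V, (∃ e ∈ DX, t ∈ e) → (∃ e ∈ DK, t ∈ e) → (t = h₀ ∨ t = h₁))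
  (haX : ∀ e ∈ DX, a ∉ e) (hbX : ∀ e ∈ DX, b ∉ e) (hcK : ∀ e ∈ DK, c ∉ e)
  (hcX0 : c ∈ cl DX h₀) (hcX1 : c ∈ cl DX h₁) (hD : ∀ e, e ∈ D ↔ e ∈ DX ∨ e ∈ DK)
  (w wX wK : Sym2 V → unitInterval) {q : ℝ} (hq : 0 < q) (hw : ∀ e, e ∉ (↑DX ∪ ↑DK : Set (Sym2 V)) → (w e : ℝ) = 0)
  (hX : ∀ e ∈ (↑DX : Set (Sym2 V)), wX e = w e) (hX' : ∀ e ∉ (↑DX : Set (Sym2 V)), wX e = 0)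
  (hY : ∀ e ∈ (↑DX : Set (Sym2 V)), wK e = 0) (hY' : ∀ e ∉ (↑DX : Set (Sym2 V)), wK e = w e)

/-! ### Near-side bookkeeping: free masses, empty events, the seven linear relations -/

include h01 in
/-- Free near-side mass = `{h₀,h₁}`-wired mass times `q^{[h₁ ∉ C(h₀)]}`. [this work] -/
theorem free_eq_jf (u : Sym2 V → unitInterval) (E : Set (BondConfig V)) :
    (∑ η : BondConfig V, rcWeightW u q ∅ η * ind E η) = ∑ η : BondConfig V, rcWeightW u q ({h₀, h₁} : Set V) η * (ind E η * (if η ∈ {η : BondConfig V | h₁ ∈ cl η.toFinset h₀} then 1 else q)) := by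
  refine Finset.sum_congr rfl fun η _ => ?_
  unfold rcWeightW
  by_cases hJ : η ∈ {η : BondConfig V | h₁ ∈ cl η.toFinset h₀}
  · rw [if_pos hJ, ApexTwoSum.k_of_mem h01 η hJ]; ring
  · rw [if_neg hJ, ApexTwoSum.k_of_not_mem h01 η hJ, pow_succ]; ring

omit [Fintype V] in
/-- The empty event carries no mass (wired form). [folklore] -/
theorem zeroW [Fintype V] (u : Sym2 V → unitInterval) (q : ℝ) :
    (∑ η : BondConfig V, rcWeightW u q ({h₀, h₁} : Set V) η * ind {η : BondConfig V | insert s(h₀, h₁) η ∈ (∅ : Set (BondConfig V))} η) = 0 :=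
  Finset.sum_eq_zero fun η _ => by
    rw [ind_of_not_mem (by simp only [Set.mem_setOf_eq, Set.mem_empty_iff_false, not_false_eq_true]), mul_zero]

omit [Fintype V] in
/-- The empty event carries no mass (free form). [folklore] -/
theorem zeroR [Fintype V] (u : Sym2 V → unitInterval) (q : ℝ) :
    (∑ η : BondConfig V, rcWeightW u q ({h₀, h₁} : Set V) η * (ind (∅ : Set (BondConfig V)) η * (if η ∈ {η : BondConfig V | h₁ ∈ cl η.toFinset h₀} then 1 else q))) = 0 :=
  Finset.sum_eq_zero fun η _ => by
    rw [ind_of_not_mem (by simp only [Set.mem_empty_iff_false, not_false_eq_true]), zero_mul, mul_zero]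

omit [Fintype V] in
/-- Pointwise-to-sum for the free-type functionals. [folklore] -/
theorem sumR_of_pt [Fintype V] (u : Sym2 V → unitInterval) (q : ℝ) {E E₁ E₂ : Set (BondConfig V)} (h : ∀ η, ind E η = ind E₁ η + ind E₂ η) :
    (∑ η : BondConfig V, rcWeightW u q ({h₀, h₁} : Set V) η * (ind E η * (if η ∈ {η : BondConfig V | h₁ ∈ cl η.toFinset h₀} then 1 else q))) =
      (∑ η : BondConfig V, rcWeightW u q ({h₀, h₁} : Set V) η * (ind E₁ η * (if η ∈ {η : BondConfig V | h₁ ∈ cl η.toFinset h₀} then 1 else q))) +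
        ∑ η : BondConfig V, rcWeightW u q ({h₀, h₁} : Set V) η * (ind E₂ η * (if η ∈ {η : BondConfig V | h₁ ∈ cl η.toFinset h₀} then 1 else q)) := by
  rw [← Finset.sum_add_distrib]
  exact Finset.sum_congr rfl fun η _ => by rw [h η]; ring

omit [Fintype V] in
/-- Pointwise-to-sum monotonicity for the free-type functionals. [folklore] -/
theorem sumR_le_of_pt [Fintype V] (u : Sym2 V → unitInterval) {q : ℝ} (hq : 0 < q) {E₁ E₂ : Set (BondConfig V)} (h : E₁ ⊆ E₂) :
    (∑ η : BondConfig V, rcWeightW u q ({h₀, h₁} : Set V) η * (ind E₁ η * (if η ∈ {η : BondConfig V | h₁ ∈ cl η.toFinset h₀} then 1 else q))) ≤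
      ∑ η : BondConfig V, rcWeightW u q ({h₀, h₁} : Set V) η * (ind E₂ η * (if η ∈ {η : BondConfig V | h₁ ∈ cl η.toFinset h₀} then 1 else q)) := by
  refine Finset.sum_le_sum fun η _ => mul_le_mul_of_nonneg_left (mul_le_mul_of_nonneg_right ?_ ?_) (rcWeightW_nonneg u hq.le _ η)
  · by_cases h1 : η ∈ E₁
    · rw [ind_of_mem h1, ind_of_mem (h h1)]
    · rw [ind_of_not_mem h1]; exact ind_nonneg _ _
  · split_ifs
    · exact zero_le_one
    · exact hq.le

omit [Fintype V] in
/-- `ind` splits along a disjoint decomposition given by a decidable case. [folklore] -/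
theorem ind_split [Fintype V] {E E₁ E₂ : Set (BondConfig V)} (η : BondConfig V) (h1 : η ∈ E₁ → η ∈ E) (h2 : η ∈ E₂ → η ∈ E)
    (h12 : η ∈ E₁ → η ∉ E₂) (h : η ∈ E → η ∈ E₁ ∨ η ∈ E₂) : ind E η = ind E₁ η + ind E₂ η := by
  by_cases e1 : η ∈ E₁
  · rw [ind_of_mem (h1 e1), ind_of_mem e1, ind_of_not_mem (h12 e1)]; ring
  · by_cases e2 : η ∈ E₂
    · rw [ind_of_mem (h2 e2), ind_of_mem e2, ind_of_not_mem e1]; ring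
    · rw [ind_of_not_mem e1, ind_of_not_mem e2, ind_of_not_mem (fun he => (h he).elim e1 e2)]; ring

/-- Relation `Um = T₀ + Uc'₀`. [this work] -/
theorem rel_Um0 : (∑ η : BondConfig V, rcWeightW wK q ({h₀, h₁} : Set V) η * (ind {η : BondConfig V | b ∈ cl η.toFinset a} η * (if η ∈ {η : BondConfig V | h₁ ∈ cl η.toFinset h₀} then 1 else q))) = (∑ η : BondConfig V, rcWeightW wK q ({h₀, h₁} : Set V) η * (ind {η : BondConfig V | b ∈ cl η.toFinset a ∧ h₀ ∈ cl η.toFinset a} η * (if η ∈ {η : BondConfig V | h₁ ∈ cl η.toFinset h₀} then 1 else q))) + (∑ η : BondConfig V, rcWeightW wK q ({h₀, h₁} : Set V) η * (ind {η : BondConfig V | b ∈ cl η.toFinset a ∧ h₀ ∉ cl η.toFinset a} η * (if η ∈ {η : BondConfig V | h₁ ∈ cl η.toFinset h₀} then 1 else q))) :=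
  sumR_of_pt wK q fun η => ind_split η (fun h => h.1) (fun h => h.1) (fun h h' => h'.2 h.2)
    (fun h => by by_cases h0 : h₀ ∈ cl η.toFinset a <;> [exact Or.inl ⟨h, h0⟩; exact Or.inr ⟨h, h0⟩])

/-- Relation `Um = T₁ + Uc'₁`. [this work] -/
theorem rel_Um1 : (∑ η : BondConfig V, rcWeightW wK q ({h₀, h₁} : Set V) η * (ind {η : BondConfig V | b ∈ cl η.toFinset a} η * (if η ∈ {η : BondConfig V | h₁ ∈ cl η.toFinset h₀} then 1 else q))) = (∑ η : BondConfig V, rcWeightW wK q ({h₀, h₁} : Set V) η * (ind {η : BondConfig V | b ∈ cl η.toFinset a ∧ h₁ ∈ cl η.toFinset a} η * (if η ∈ {η : BondConfig V | h₁ ∈ cl η.toFinset h₀} then 1 else q))) + (∑ η : BondConfig V, rcWeightW wK q ({h₀, h₁} : Set V) η * (ind {η : BondConfig V | b ∈ cl η.toFinset a ∧ h₁ ∉ cl η.toFinset a} η * (if η ∈ {η : BondConfig V | h₁ ∈ cl η.toFinset h₀} then 1 else q))) :=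
  sumR_of_pt wK q fun η => ind_split η (fun h => h.1) (fun h => h.1) (fun h h' => h'.2 h.2)
    (fun h => by by_cases h1 : h₁ ∈ cl η.toFinset a <;> [exact Or.inl ⟨h, h1⟩; exact Or.inr ⟨h, h1⟩])

/-- Relation `R_F(S) = Sb₀ + Uc'₀`. [this work] -/
theorem rel_RF : (∑ η : BondConfig V, rcWeightW wK q ({h₀, h₁} : Set V) η * (ind {η : BondConfig V | b ∉ cl η.toFinset a ∧ (h₀ ∈ cl η.toFinset a ∨ Sep DK (cl η.toFinset a) b h₀) ∧ (h₁ ∈ cl η.toFinset a ∨ Sep DK (cl η.toFinset a) b h₁ ∨ h₀ ∈ cl η.toFinset a)} η * (if η ∈ {η : BondConfig V | h₁ ∈ cl η.toFinset h₀} then 1 else q))) = (∑ η : BondConfig V, rcWeightW wK q ({h₀, h₁} : Set V) η * (ind {η : BondConfig V | b ∉ cl η.toFinset a ∧ h₀ ∉ cl η.toFinset a ∧ Sep DK (cl η.toFinset a) b h₀ ∧ (h₁ ∈ cl η.toFinset a ∨ Sep DK (cl η.toFinset a) b h₁)} η * (if η ∈ {η : BondConfig V | h₁ ∈ cl η.toFinset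 h₀} then 1 else q))) + (∑ η : BondConfig V, rcWeightW wK q ({h₀, h₁} : Set V) η * (ind {η : BondConfig V | b ∉ cl η.toFinset a ∧ h₀ ∈ cl η.toFinset a} η * (if η ∈ {η : BondConfig V | h₁ ∈ cl η.toFinset h₀} then 1 else q))) := by
  refine sumR_of_pt wK q fun η => ind_split η ?_ ?_ ?_ ?_
  · rintro ⟨hb, h0, s0, h1⟩; exact ⟨hb, Or.inr s0, h1.elim Or.inl (fun h => Or.inr (Or.inl h))⟩
  · rintro ⟨hb, h0⟩; exact ⟨hb, Or.inl h0, Or.inr (Or.inr h0)⟩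
  · rintro ⟨-, h0, -⟩ ⟨-, h0'⟩; exact h0 h0'
  · rintro ⟨hb, h1, h2⟩
    by_cases h0 : h₀ ∈ cl η.toFinset a
    · exact Or.inr ⟨hb, h0⟩
    · refine Or.inl ⟨hb, h0, h1.resolve_left h0, ?_⟩
      rcases h2 with h | h | h
      · exact Or.inl h
      · exact Or.inr h
      · exact absurd h h0

/-- Relation `R_G(S) = Sb₁ + Uc'₁`. [this work] -/
theorem rel_RG : (∑ η : BondConfig V, rcWeightW wK q ({h₀, h₁} : Set V) η * (ind {η : BondConfig V | b ∉ cl η.toFinset a ∧ (h₀ ∈ cl η.toFinset a ∨ Sep DK (cl η.toFinset a) b h₀ ∨ h₁ ∈ cl η.toFinset a) ∧ (h₁ ∈ cl η.toFinset a ∨ Sep DK (cl η.toFinset a) b h₁)} η * (if η ∈ {η : BondConfig V | h₁ ∈ cl η.toFinset h₀} then 1 else q))) = (∑ η : BondConfig V, rcWeightW wK q ({h₀, h₁} : Set V) η * (ind {η : BondConfig V | b ∉ cl η.toFinset a ∧ h₁ ∉ cl η.toFinset a ∧ Sep DK (cl η.toFinset a) b h₁ ∧ (h₀ ∈ cl η.toFinset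 a ∨ Sep DK (cl η.toFinset a) b h₀)} η * (if η ∈ {η : BondConfig V | h₁ ∈ cl η.toFinset h₀} then 1 else q))) + (∑ η : BondConfig V, rcWeightW wK q ({h₀, h₁} : Set V) η * (ind {η : BondConfig V | b ∉ cl η.toFinset a ∧ h₁ ∈ cl η.toFinset a} η * (if η ∈ {η : BondConfig V | h₁ ∈ cl η.toFinset h₀} then 1 else q))) := by
  refine sumR_of_pt wK q fun η => ind_split η ?_ ?_ ?_ ?_
  · rintro ⟨hb, h1, s1, h0⟩; exact ⟨hb, h0.elim Or.inl (fun h => Or.inr (Or.inl h)), Or.inr s1⟩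
  · rintro ⟨hb, h1⟩; exact ⟨hb, Or.inr (Or.inr h1), Or.inl h1⟩
  · rintro ⟨-, h1, -⟩ ⟨-, h1'⟩; exact h1 h1'
  · rintro ⟨hb, h1, h2⟩
    by_cases g1 : h₁ ∈ cl η.toFinset a
    · exact Or.inr ⟨hb, g1⟩
    · refine Or.inl ⟨hb, g1, h2.resolve_left g1, ?_⟩
      rcases h1 with h | h | h
      · exact Or.inl h
      · exact Or.inr h
      · exact absurd h g1

/-- Relation `R_H(S) = R_F(S) + R_G(S) − Sm`. [this work] -/
theorem rel_RH : (∑ η : BondConfig V, rcWeightW wK q ({h₀, h₁} : Set V) η * (ind {η : BondConfig V | b ∉ cl η.toFinset a ∧ (h₀ ∈ cl η.toFinset a ∨ Sep DK (cl η.toFinset a) b h₀ ∨ h₁ ∈ cl η.toFinset a) ∧ (h₁ ∈ cl η.toFinset a ∨ Sep DK (cl η.toFinset a) b h₁ ∨ h₀ ∈ cl η.toFinset a)} η * (if η ∈ {η : BondConfig V | h₁ ∈ cl η.toFinset h₀} then 1 else q))) = (∑ η : BondConfig V, rcWeightW wK q ({h₀, h₁} : Set V) η * (ind {η : BondConfig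 V | b ∉ cl η.toFinset a ∧ (h₀ ∈ cl η.toFinset a ∨ Sep DK (cl η.toFinset a) b h₀) ∧ (h₁ ∈ cl η.toFinset a ∨ Sep DK (cl η.toFinset a) b h₁ ∨ h₀ ∈ cl η.toFinset a)} η * (if η ∈ {η : BondConfig V | h₁ ∈ cl η.toFinset h₀} then 1 else q))) + (∑ η : BondConfig V, rcWeightW wK q ({h₀, h₁} : Set V) η * (ind {η : BondConfig V | b ∉ cl η.toFinset a ∧ (h₀ ∈ cl η.toFinset a ∨ Sep DK (cl η.toFinset a) b h₀ ∨ h₁ ∈ cl η.toFinset a) ∧ (h₁ ∈ cl η.toFinset a ∨ Sep DK (cl η.toFinset a) b h₁)} η * (if η ∈ {η : BondConfig V | h₁ ∈ cl η.toFinset h₀} then 1 else q))) - (∑ η : BondConfig V, rcWeightW wK q ({h₀, h₁} : Set V) η * (ind {η : BondConfig V | b ∉ cl η.toFinset a ∧ (h₀ ∈ cl η.toFinset a ∨ Sep DK (cl η.toFinset a) b h₀) ∧ (h₁ ∈ cl η.toFinset a ∨ Sep DK (cl η.toFinset a) b h₁)} η * (if η ∈ {η : BondConfig V | h₁ ∈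 cl η.toFinset h₀} then 1 else q))) := by
  rw [eq_sub_iff_add_eq, ← Finset.sum_add_distrib, ← Finset.sum_add_distrib]
  refine Finset.sum_congr rfl fun η _ => ?_
  have key : ind {η : BondConfig V | b ∉ cl η.toFinset a ∧ (h₀ ∈ cl η.toFinset a ∨ Sep DK (cl η.toFinset a) b h₀ ∨ h₁ ∈ cl η.toFinset a) ∧ (h₁ ∈ cl η.toFinset a ∨ Sep DK (cl η.toFinset a) b h₁ ∨ h₀ ∈ cl η.toFinset a)} η + ind {η : BondConfig V | b ∉ cl η.toFinset a ∧ (h₀ ∈ cl η.toFinset a ∨ Sep DK (cl η.toFinset a) b h₀) ∧ (h₁ ∈ cl η.toFinset a ∨ Sep DK (cl η.toFinset a) b h₁)} η = ind {η : BondConfig V | b ∉ cl η.toFinset a ∧ (h₀ ∈ cl η.toFinset a ∨ Sep DK (cl η.toFinset a) b h₀) ∧ (h₁ ∈ cl η.toFinset a ∨ Sep DK (cl η.toFinset a) b h₁ ∨ h₀ ∈ cl η.toFinset a)} η + ind {η : BondConfig V | b ∉ cl η.toFinset a ∧ (h₀ ∈ cl η.toFinset a ∨ Sep DK (cl η.toFinset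 a) b h₀ ∨ h₁ ∈ cl η.toFinset a) ∧ (h₁ ∈ cl η.toFinset a ∨ Sep DK (cl η.toFinset a) b h₁)} η := by
    by_cases hb : b ∈ cl η.toFinset a
    · rw [ind_of_not_mem (fun h => h.1 hb), ind_of_not_mem (fun h => h.1 hb), ind_of_not_mem (fun h => h.1 hb),
        ind_of_not_mem (fun h => h.1 hb)]
    by_cases g0 : h₀ ∈ cl η.toFinset a
    · have eH : η ∈ {η : BondConfig V | b ∉ cl η.toFinset a ∧ (h₀ ∈ cl η.toFinset a ∨ Sep DK (cl η.toFinset a) b h₀ ∨ h₁ ∈ cl η.toFinset a) ∧ (h₁ ∈ cl η.toFinset a ∨ Sep DK (cl η.toFinset a) b h₁ ∨ h₀ ∈ cl η.toFinset a)} := ⟨hb, Or.inl g0, Or.inr (Or.inr g0)⟩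
      have eF : η ∈ {η : BondConfig V | b ∉ cl η.toFinset a ∧ (h₀ ∈ cl η.toFinset a ∨ Sep DK (cl η.toFinset a) b h₀) ∧ (h₁ ∈ cl η.toFinset a ∨ Sep DK (cl η.toFinset a) b h₁ ∨ h₀ ∈ cl η.toFinset a)} := ⟨hb, Or.inl g0, Or.inr (Or.inr g0)⟩
      rw [ind_of_mem eH, ind_of_mem eF]
      by_cases hx : h₁ ∈ cl η.toFinset a ∨ Sep DK (cl η.toFinset a) b h₁
      · rw [ind_of_mem (show η ∈ {η : BondConfig V | b ∉ cl η.toFinset a ∧ (h₀ ∈ cl η.toFinset a ∨ Sep DK (cl η.toFinset a) b h₀) ∧ (h₁ ∈ cl η.toFinset a ∨ Sep DK (cl η.toFinset a) b h₁)} from ⟨hb, Or.inl g0, hx⟩), ind_of_mem (show η ∈ {η : BondConfig V | b ∉ cl η.toFinset a ∧ (h₀ ∈ cl η.toFinset a ∨ Sep DK (cl η.toFinset a) b h₀ ∨ h₁ ∈ cl η.toFinset a) ∧ (h₁ ∈ cl η.toFinset a ∨ Sep DK (cl η.toFinset a) b h₁)} from ⟨hb, Or.inl g0, hx⟩)]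
      · rw [ind_of_not_mem (fun h => hx h.2.2), ind_of_not_mem (fun h => hx h.2.2)]
    by_cases g1 : h₁ ∈ cl η.toFinset a
    · have eH : η ∈ {η : BondConfig V | b ∉ cl η.toFinset a ∧ (h₀ ∈ cl η.toFinset a ∨ Sep DK (cl η.toFinset a) b h₀ ∨ h₁ ∈ cl η.toFinset a) ∧ (h₁ ∈ cl η.toFinset a ∨ Sep DK (cl η.toFinset a) b h₁ ∨ h₀ ∈ cl η.toFinset a)} := ⟨hb, Or.inr (Or.inr g1), Or.inl g1⟩
      have eG : η ∈ {η : BondConfig V | b ∉ cl η.toFinset a ∧ (h₀ ∈ cl η.toFinset a ∨ Sep DK (cl η.toFinset a) b h₀ ∨ h₁ ∈ cl η.toFinset a) ∧ (h₁ ∈ cl η.toFinset a ∨ Sep DK (cl η.toFinset a) b h₁)} := ⟨hb, Or.inr (Or.inr g1), Or.inl g1⟩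
      rw [ind_of_mem eH, ind_of_mem eG]
      by_cases hx : Sep DK (cl η.toFinset a) b h₀
      · rw [ind_of_mem (show η ∈ {η : BondConfig V | b ∉ cl η.toFinset a ∧ (h₀ ∈ cl η.toFinset a ∨ Sep DK (cl η.toFinset a) b h₀) ∧ (h₁ ∈ cl η.toFinset a ∨ Sep DK (cl η.toFinset a) b h₁)} from ⟨hb, Or.inr hx, Or.inl g1⟩), ind_of_mem (show η ∈ {η : BondConfig V | b ∉ cl η.toFinset a ∧ (h₀ ∈ cl η.toFinset a ∨ Sep DK (cl η.toFinset a) b h₀) ∧ (h₁ ∈ cl η.toFinset a ∨ Sep DK (cl η.toFinset a) b h₁ ∨ h₀ ∈ cl η.toFinset a)} from ⟨hb, Or.inr hx, Or.inl g1⟩)]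
      · rw [ind_of_not_mem (fun h => (h.2.1.resolve_left g0) |> hx), ind_of_not_mem (fun h => (h.2.1.resolve_left g0) |> hx)]; ring
    -- no hub in `C(a)`: all four events coincide
    by_cases hx : Sep DK (cl η.toFinset a) b h₀ ∧ Sep DK (cl η.toFinset a) b h₁
    · rw [ind_of_mem (show η ∈ {η : BondConfig V | b ∉ cl η.toFinset a ∧ (h₀ ∈ cl η.toFinset a ∨ Sep DK (cl η.toFinset a) b h₀ ∨ h₁ ∈ cl η.toFinset a) ∧ (h₁ ∈ cl η.toFinset a ∨ Sep DK (cl η.toFinset a) b h₁ ∨ h₀ ∈ cl η.toFinset a)} from ⟨hb, Or.inr (Or.inl hx.1), Or.inr (Or.inl hx.2)⟩),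
        ind_of_mem (show η ∈ {η : BondConfig V | b ∉ cl η.toFinset a ∧ (h₀ ∈ cl η.toFinset a ∨ Sep DK (cl η.toFinset a) b h₀) ∧ (h₁ ∈ cl η.toFinset a ∨ Sep DK (cl η.toFinset a) b h₁)} from ⟨hb, Or.inr hx.1, Or.inr hx.2⟩),
        ind_of_mem (show η ∈ {η : BondConfig V | b ∉ cl η.toFinset a ∧ (h₀ ∈ cl η.toFinset a ∨ Sep DK (cl η.toFinset a) b h₀) ∧ (h₁ ∈ cl η.toFinset a ∨ Sep DK (cl η.toFinset a) b h₁ ∨ h₀ ∈ cl η.toFinset a)} from ⟨hb, Or.inr hx.1, Or.inr (Or.inl hx.2)⟩),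
        ind_of_mem (show η ∈ {η : BondConfig V | b ∉ cl η.toFinset a ∧ (h₀ ∈ cl η.toFinset a ∨ Sep DK (cl η.toFinset a) b h₀ ∨ h₁ ∈ cl η.toFinset a) ∧ (h₁ ∈ cl η.toFinset a ∨ Sep DK (cl η.toFinset a) b h₁)} from ⟨hb, Or.inr (Or.inl hx.1), Or.inr hx.2⟩)]
    · have nH : η ∉ {η : BondConfig V | b ∉ cl η.toFinset a ∧ (h₀ ∈ cl η.toFinset a ∨ Sep DK (cl η.toFinset a) b h₀ ∨ h₁ ∈ cl η.toFinset a) ∧ (h₁ ∈ cl η.toFinset a ∨ Sep DK (cl η.toFinset a) b h₁ ∨ h₀ ∈ cl η.toFinset a)} := fun h => hx ⟨(h.2.1.resolve_left g0).elim id (fun h' => absurd h' g1),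
        (h.2.2.resolve_left g1).elim id (fun h' => absurd h' g0)⟩
      have nS : η ∉ {η : BondConfig V | b ∉ cl η.toFinset a ∧ (h₀ ∈ cl η.toFinset a ∨ Sep DK (cl η.toFinset a) b h₀) ∧ (h₁ ∈ cl η.toFinset a ∨ Sep DK (cl η.toFinset a) b h₁)} := fun h => hx ⟨h.2.1.resolve_left g0, h.2.2.resolve_left g1⟩
      have nF : η ∉ {η : BondConfig V | b ∉ cl η.toFinset a ∧ (h₀ ∈ cl η.toFinset a ∨ Sep DK (cl η.toFinset a) b h₀) ∧ (h₁ ∈ cl η.toFinset a ∨ Sep DK (cl η.toFinset a) b h₁ ∨ h₀ ∈ cl η.toFinset a)} := fun h => hx ⟨h.2.1.resolve_left g0, (h.2.2.resolve_left g1).elim id (fun h' => absurd h' g0)⟩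
      have nG : η ∉ {η : BondConfig V | b ∉ cl η.toFinset a ∧ (h₀ ∈ cl η.toFinset a ∨ Sep DK (cl η.toFinset a) b h₀ ∨ h₁ ∈ cl η.toFinset a) ∧ (h₁ ∈ cl η.toFinset a ∨ Sep DK (cl η.toFinset a) b h₁)} := fun h => hx ⟨(h.2.1.resolve_left g0).elim id (fun h' => absurd h' g1), h.2.2.resolve_left g1⟩
      rw [ind_of_not_mem nH, ind_of_not_mem nS, ind_of_not_mem nF, ind_of_not_mem nG]
  calc rcWeightW wK q ({h₀, h₁} : Set V) η * (ind {η : BondConfig V | b ∉ cl η.toFinset a ∧ (h₀ ∈ cl η.toFinset a ∨ Sep DK (cl η.toFinset a) b h₀ ∨ h₁ ∈ cl η.toFinset a) ∧ (h₁ ∈ cl η.toFinset a ∨ Sep DK (cl η.toFinset a) b h₁ ∨ h₀ ∈ cl η.toFinset a)} η * (if η ∈ {η : BondConfig V | h₁ ∈ cl η.toFinset h₀} then 1 else q)) + rcWeightW wK q ({h₀, h₁} : Set V) η * (ind {η : BondConfig V | b ∉ cl η.toFinset a ∧ (h₀ ∈ cl η.toFinset a ∨ Sep DK (cl η.toFinset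 a) b h₀) ∧ (h₁ ∈ cl η.toFinset a ∨ Sep DK (cl η.toFinset a) b h₁)} η * (if η ∈ {η : BondConfig V | h₁ ∈ cl η.toFinset h₀} then 1 else q))
      = rcWeightW wK q ({h₀, h₁} : Set V) η * ((ind {η : BondConfig V | b ∉ cl η.toFinset a ∧ (h₀ ∈ cl η.toFinset a ∨ Sep DK (cl η.toFinset a) b h₀ ∨ h₁ ∈ cl η.toFinset a) ∧ (h₁ ∈ cl η.toFinset a ∨ Sep DK (cl η.toFinset a) b h₁ ∨ h₀ ∈ cl η.toFinset a)} η + ind {η : BondConfig V | b ∉ cl η.toFinset a ∧ (h₀ ∈ cl η.toFinset a ∨ Sep DK (cl η.toFinset a) b h₀) ∧ (h₁ ∈ cl η.toFinset a ∨ Sep DK (cl η.toFinset a) b h₁)} η) * (if η ∈ {η : BondConfig V | h₁ ∈ cl η.toFinset h₀} then 1 else q)) := by ring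
    _ = rcWeightW wK q ({h₀, h₁} : Set V) η * ((ind {η : BondConfig V | b ∉ cl η.toFinset a ∧ (h₀ ∈ cl η.toFinset a ∨ Sep DK (cl η.toFinset a) b h₀) ∧ (h₁ ∈ cl η.toFinset a ∨ Sep DK (cl η.toFinset a) b h₁ ∨ h₀ ∈ cl η.toFinset a)} η + ind {η : BondConfig V | b ∉ cl η.toFinset a ∧ (h₀ ∈ cl η.toFinset a ∨ Sep DK (cl η.toFinset a) b h₀ ∨ h₁ ∈ cl η.toFinset a) ∧ (h₁ ∈ cl η.toFinset a ∨ Sep DK (cl η.toFinset a) b h₁)} η) * (if η ∈ {η : BondConfig V | h₁ ∈ cl η.toFinset h₀} then 1 else q)) := by rw [key]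
    _ = _ := by ring

/-- Relation `R_B(U_b) = T^w + Ub'^w` (hub-wired). [this work] -/
theorem rel_RBUb : (∑ η : BondConfig V, rcWeightW wK q ({h₀, h₁} : Set V) η * ind {η : BondConfig V | insert s(h₀, h₁) η ∈ {η : BondConfig V | b ∈ cl η.toFinset a}} η) = (∑ η : BondConfig V, rcWeightW wK q ({h₀, h₁} : Set V) η * ind {η : BondConfig V | insert s(h₀, h₁) η ∈ {η : BondConfig V | b ∈ cl η.toFinset a ∧ h₀ ∈ cl η.toFinset a}} η) + (∑ η : BondConfig V, rcWeightW wK q ({h₀, h₁} : Set V) η * ind {η : BondConfig V | insert s(h₀, h₁) η ∈ {η : BondConfig V | b ∈ cl η.toFinset a ∧ h₀ ∉ cl η.toFinset a}} η) := by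
  rw [← Finset.sum_add_distrib]
  refine Finset.sum_congr rfl fun η _ => ?_
  rw [← mul_add]
  congr 1
  refine ind_split η (fun h => ?_) (fun h => ?_) (fun h h' => ?_) (fun h => ?_)
  · exact h.1
  · exact h.1
  · exact h'.2 h.2
  · by_cases h0 : insert s(h₀, h₁) η ∈ {η : BondConfig V | h₀ ∈ cl η.toFinset a}
    · exact Or.inl ⟨h, h0⟩
    · exact Or.inr ⟨h, h0⟩

include h01 in
/-- Relation `R_B(S) = S^w + Uc'^w` (hub-wired; uses that the inserted pair joins the hubs). [this work] -/
theorem rel_RBS : (∑ η : BondConfig V, rcWeightW wK q ({h₀, h₁} : Set V) η * ind {η : BondConfig V | insert s(h₀, h₁) η ∈ {η : BondConfig V | b ∉ cl η.toFinset a ∧ (h₀ ∈ cl η.toFinset a ∨ Sep DK (cl η.toFinset a) b h₀) ∧ (h₁ ∈ cl η.toFinset a ∨ Sep DK (cl η.toFinset a) b h₁)}} η) = (∑ η : BondConfig V, rcWeightW wK q ({h₀, h₁} : Set V) η * ind {η : BondConfig V | insert s(h₀, h₁) η ∈ {η : BondConfig V | b ∉ cl η.toFinset a ∧ h₀ ∉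 cl η.toFinset a ∧ Sep DK (cl η.toFinset a) b h₀ ∧ Sep DK (cl η.toFinset a) b h₁}} η) + (∑ η : BondConfig V, rcWeightW wK q ({h₀, h₁} : Set V) η * ind {η : BondConfig V | insert s(h₀, h₁) η ∈ {η : BondConfig V | b ∉ cl η.toFinset a ∧ h₀ ∈ cl η.toFinset a}} η) := by
  rw [← Finset.sum_add_distrib]
  refine Finset.sum_congr rfl fun η _ => ?_
  rw [← mul_add]
  congr 1
  have hh := hubs_iff_insert (a := a) h01 η
  refine ind_split η (fun h => ?_) (fun h => ?_) (fun h h' => ?_) (fun h => ?_)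
  · exact ⟨h.1, Or.inr h.2.2.1, Or.inr h.2.2.2⟩
  · exact ⟨h.1, Or.inl h.2, Or.inl (hh.1 h.2)⟩
  · exact h.2.1 h'.2
  · by_cases h0 : insert s(h₀, h₁) η ∈ {η : BondConfig V | h₀ ∈ cl η.toFinset a}
    · exact Or.inr ⟨h.1, h0⟩
    · have h1 : insert s(h₀, h₁) η ∉ {η : BondConfig V | h₁ ∈ cl η.toFinset a} := fun h' => h0 (hh.2 h')
      exact Or.inl ⟨h.1, h0, h.2.1.resolve_left h0, h.2.2.resolve_left h1⟩

/-! ### Arm bookkeeping: the `E`, `N`, `M` cells split along the flags -/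

include hX' in
/-- Off the arm support the arm weight vanishes. [folklore] -/
theorem rcW_arm_zero {η : BondConfig V} (hη : ¬ η ⊆ ↑DX) : rcWeightW wX q ({h₀, h₁} : Set V) η = 0 := by
  obtain ⟨e, heη, heD⟩ := Set.not_subset.1 hη
  unfold rcWeightW
  rw [ApexTwoSum.weight_eq_zero_of_mem_not_mem wX (fun e he => by rw [hX' e he]; rfl) heη heD, zero_mul]

/-- `E = E ⊔ F ⊔ G ⊔ H` (the all-apart cell splits along the two flags). [this work] -/
theorem sum_E_split :
    (∑ η : BondConfig V, rcWeightW wX q ({h₀, h₁} : Set V) η * ind {η : BondConfig V | c ∉ cl η.toFinset h₀ ∧ h₁ ∉ cl η.toFinset h₀ ∧ h₁ ∉ cl η.toFinset c} η) = (∑ η : BondConfig V, rcWeightW wX q ({h₀, h₁} : Set V) η * ind {η : BondConfig V | c ∉ cl η.toFinset h₀ ∧ h₁ ∉ cl η.toFinset h₀ ∧ h₁ ∉ cl η.toFinset c ∧ ¬ Sep DX (cl η.toFinset h₀) c h₁ ∧ ¬ Sep DX (cl η.toFinset h₁) c h₀} η) + (∑ η : BondConfig V, rcWeightW wX q ({h₀,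 h₁} : Set V) η * ind {η : BondConfig V | c ∉ cl η.toFinset h₀ ∧ h₁ ∉ cl η.toFinset h₀ ∧ h₁ ∉ cl η.toFinset c ∧ Sep DX (cl η.toFinset h₀) c h₁ ∧ ¬ Sep DX (cl η.toFinset h₁) c h₀} η) + (∑ η : BondConfig V, rcWeightW wX q ({h₀, h₁} : Set V) η * ind {η : BondConfig V | c ∉ cl η.toFinset h₀ ∧ h₁ ∉ cl η.toFinset h₀ ∧ h₁ ∉ cl η.toFinset c ∧ ¬ Sep DX (cl η.toFinset h₀) c h₁ ∧ Sep DX (cl η.toFinset h₁) c h₀} η) + (∑ η : BondConfig V, rcWeightW wX q ({h₀, h₁} : Set V) η * ind {η : BondConfig V | c ∉ cl η.toFinset h₀ ∧ h₁ ∉ cl η.toFinset h₀ ∧ h₁ ∉ cl η.toFinset c ∧ Sep DX (cl η.toFinset h₀) c h₁ ∧ Sep DX (cl η.toFinset h₁) c h₀} η) := by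
  rw [← Finset.sum_add_distrib, ← Finset.sum_add_distrib, ← Finset.sum_add_distrib]
  refine Finset.sum_congr rfl fun η _ => ?_
  have key : ind {η : BondConfig V | c ∉ cl η.toFinset h₀ ∧ h₁ ∉ cl η.toFinset h₀ ∧ h₁ ∉ cl η.toFinset c} η = ind {η : BondConfig V | c ∉ cl η.toFinset h₀ ∧ h₁ ∉ cl η.toFinset h₀ ∧ h₁ ∉ cl η.toFinset c ∧ ¬ Sep DX (cl η.toFinset h₀) c h₁ ∧ ¬ Sep DX (cl η.toFinset h₁) c h₀} η + ind {η : BondConfig V | c ∉ cl η.toFinset h₀ ∧ h₁ ∉ cl η.toFinset h₀ ∧ h₁ ∉ cl η.toFinset c ∧ Sep DX (cl η.toFinset h₀) c h₁ ∧ ¬ Sep DX (cl η.toFinset h₁) c h₀} η + ind {η : BondConfig V | c ∉ cl η.toFinset h₀ ∧ h₁ ∉ cl η.toFinset h₀ ∧ h₁ ∉ cl η.toFinset c ∧ ¬ Sep DX (cl η.toFinset h₀) c h₁ ∧ Sep DX (cl η.toFinset h₁) c h₀} η + ind {η : BondConfig V | c ∉ cl η.toFinset h₀ ∧ h₁ ∉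 cl η.toFinset h₀ ∧ h₁ ∉ cl η.toFinset c ∧ Sep DX (cl η.toFinset h₀) c h₁ ∧ Sep DX (cl η.toFinset h₁) c h₀} η := by
    by_cases hb : η ∈ {η : BondConfig V | c ∉ cl η.toFinset h₀ ∧ h₁ ∉ cl η.toFinset h₀ ∧ h₁ ∉ cl η.toFinset c}
    · obtain ⟨c0, c1, c2⟩ := hb
      by_cases n0 : Sep DX (cl η.toFinset h₀) c h₁ <;> by_cases n1 : Sep DX (cl η.toFinset h₁) c h₀
      · rw [ind_of_mem (show η ∈ {η : BondConfig V | c ∉ cl η.toFinset h₀ ∧ h₁ ∉ cl η.toFinset h₀ ∧ h₁ ∉ cl η.toFinset c} from ⟨c0, c1, c2⟩), ind_of_not_mem (fun h => h.2.2.2.1 n0), ind_of_not_mem (fun h => h.2.2.2.2 n1),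
          ind_of_not_mem (fun h => h.2.2.2.1 n0), ind_of_mem (show η ∈ {η : BondConfig V | c ∉ cl η.toFinset h₀ ∧ h₁ ∉ cl η.toFinset h₀ ∧ h₁ ∉ cl η.toFinset c ∧ Sep DX (cl η.toFinset h₀) c h₁ ∧ Sep DX (cl η.toFinset h₁) c h₀} from ⟨c0, c1, c2, n0, n1⟩)]; ring
      · rw [ind_of_mem (show η ∈ {η : BondConfig V | c ∉ cl η.toFinset h₀ ∧ h₁ ∉ cl η.toFinset h₀ ∧ h₁ ∉ cl η.toFinset c} from ⟨c0, c1, c2⟩), ind_of_not_mem (fun h => h.2.2.2.1 n0), ind_of_mem (show η ∈ {η : BondConfig V | c ∉ cl η.toFinset h₀ ∧ h₁ ∉ cl η.toFinset h₀ ∧ h₁ ∉ cl η.toFinset c ∧ Sep DX (cl η.toFinset h₀) c h₁ ∧ ¬ Sep DX (cl η.toFinset h₁) c h₀} from ⟨c0, c1, c2, n0, n1⟩),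
          ind_of_not_mem (fun h => h.2.2.2.1 n0), ind_of_not_mem (fun h => n1 h.2.2.2.2)]; ring
      · rw [ind_of_mem (show η ∈ {η : BondConfig V | c ∉ cl η.toFinset h₀ ∧ h₁ ∉ cl η.toFinset h₀ ∧ h₁ ∉ cl η.toFinset c} from ⟨c0, c1, c2⟩), ind_of_not_mem (fun h => h.2.2.2.2 n1), ind_of_not_mem (fun h => n0 h.2.2.2.1),
          ind_of_mem (show η ∈ {η : BondConfig V | c ∉ cl η.toFinset h₀ ∧ h₁ ∉ cl η.toFinset h₀ ∧ h₁ ∉ cl η.toFinset c ∧ ¬ Sep DX (cl η.toFinset h₀) c h₁ ∧ Sep DX (cl η.toFinset h₁) c h₀} from ⟨c0, c1, c2, n0, n1⟩), ind_of_not_mem (fun h => n0 h.2.2.2.1)]; ring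
      · rw [ind_of_mem (show η ∈ {η : BondConfig V | c ∉ cl η.toFinset h₀ ∧ h₁ ∉ cl η.toFinset h₀ ∧ h₁ ∉ cl η.toFinset c} from ⟨c0, c1, c2⟩), ind_of_mem (show η ∈ {η : BondConfig V | c ∉ cl η.toFinset h₀ ∧ h₁ ∉ cl η.toFinset h₀ ∧ h₁ ∉ cl η.toFinset c ∧ ¬ Sep DX (cl η.toFinset h₀) c h₁ ∧ ¬ Sep DX (cl η.toFinset h₁) c h₀} from ⟨c0, c1, c2, n0, n1⟩), ind_of_not_mem (fun h => n0 h.2.2.2.1),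
          ind_of_not_mem (fun h => n1 h.2.2.2.2), ind_of_not_mem (fun h => n0 h.2.2.2.1)]; ring
    · rw [ind_of_not_mem hb, ind_of_not_mem (fun h => hb ⟨h.1, h.2.1, h.2.2.1⟩), ind_of_not_mem (fun h => hb ⟨h.1, h.2.1, h.2.2.1⟩),
        ind_of_not_mem (fun h => hb ⟨h.1, h.2.1, h.2.2.1⟩), ind_of_not_mem (fun h => hb ⟨h.1, h.2.1, h.2.2.1⟩)]; ring
  calc rcWeightW wX q ({h₀, h₁} : Set V) η * ind {η : BondConfig V | c ∉ cl η.toFinset h₀ ∧ h₁ ∉ cl η.toFinset h₀ ∧ h₁ ∉ cl η.toFinset c} η = rcWeightW wX q ({h₀, h₁} : Set V) η * (ind {η : BondConfig V | c ∉ cl η.toFinset h₀ ∧ h₁ ∉ cl η.toFinset h₀ ∧ h₁ ∉ cl η.toFinset c ∧ ¬ Sep DX (cl η.toFinset h₀) c h₁ ∧ ¬ Sep DX (cl η.toFinset h₁) c h₀} η + ind {η : BondConfig V | c ∉ cl η.toFinset h₀ ∧ h₁ ∉ cl η.toFinset h₀ ∧ h₁ ∉ cl η.toFinset c ∧ Sep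 DX (cl η.toFinset h₀) c h₁ ∧ ¬ Sep DX (cl η.toFinset h₁) c h₀} η + ind {η : BondConfig V | c ∉ cl η.toFinset h₀ ∧ h₁ ∉ cl η.toFinset h₀ ∧ h₁ ∉ cl η.toFinset c ∧ ¬ Sep DX (cl η.toFinset h₀) c h₁ ∧ Sep DX (cl η.toFinset h₁) c h₀} η + ind {η : BondConfig V | c ∉ cl η.toFinset h₀ ∧ h₁ ∉ cl η.toFinset h₀ ∧ h₁ ∉ cl η.toFinset c ∧ Sep DX (cl η.toFinset h₀) c h₁ ∧ Sep DX (cl η.toFinset h₁) c h₀} η) := by rw [key]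
    _ = _ := by ring

include hX' in
/-- `N = F ⊔ H` (the separating cell at `h₀` is all-apart with flag `N₀`). [this work] -/
theorem sum_N_split :
    (∑ η : BondConfig V, rcWeightW wX q ({h₀, h₁} : Set V) η * ind {η : BondConfig V | c ∉ cl η.toFinset h₀ ∧ h₁ ∉ cl η.toFinset h₀ ∧ Sep DX (cl η.toFinset h₀) c h₁} η) = (∑ η : BondConfig V, rcWeightW wX q ({h₀, h₁} : Set V) η * ind {η : BondConfig V | c ∉ cl η.toFinset h₀ ∧ h₁ ∉ cl η.toFinset h₀ ∧ h₁ ∉ cl η.toFinset c ∧ Sep DX (cl η.toFinset h₀) c h₁ ∧ ¬ Sep DX (cl η.toFinset h₁) c h₀} η) + (∑ η : BondConfig V, rcWeightW wX q ({h₀, h₁} : Set V) η * ind {η : BondConfig V | c ∉ cl η.toFinset h₀ ∧ h₁ ∉ cl η.toFinset h₀ ∧ h₁ ∉ cl η.toFinset c ∧ Sep DX (cl η.toFinset h₀) c h₁ ∧ Sep DX (cl η.toFinset h₁) c h₀} η) := by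
  rw [← Finset.sum_add_distrib]
  refine Finset.sum_congr rfl fun η _ => ?_
  by_cases hη : η ⊆ ↑DX
  swap
  · rw [rcW_arm_zero wX hX' hη]; ring
  have hζ : η.toFinset ⊆ DX := fun e he => by rw [Set.mem_toFinset] at he; exact hη he
  rw [← mul_add]
  congr 1
  refine ind_split η (fun h => ⟨h.1, h.2.1, h.2.2.2.1⟩) (fun h => ⟨h.1, h.2.1, h.2.2.2.1⟩) (fun h h' => h.2.2.2.2 h'.2.2.2.2) ?_
  rintro ⟨c0, c1, n0⟩
  have c2 : h₁ ∉ cl η.toFinset c := fun hc =>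
    (show ¬ Sep DX (cl η.toFinset h₀) c h₁ from by
      unfold RefinedRowR3.Sep; rw [not_not]
      exact mem_cl_sdiff_touch hζ (fun t ht htU => c0 (mem_cl_trans htU (mem_cl_comm.1 ht))) hc) n0
  by_cases n1 : Sep DX (cl η.toFinset h₁) c h₀
  · exact Or.inr ⟨c0, c1, c2, n0, n1⟩
  · exact Or.inl ⟨c0, c1, c2, n0, n1⟩

include hX' in
/-- `M = G ⊔ H` (the separating cell at `h₁`, rooted at `h₁`, is all-apart with flag `N₁`). [this work] -/
theorem sum_M_split :
    (∑ η : BondConfig V, rcWeightW wX q ({h₀, h₁} : Set V) η * ind {η : BondConfig V | c ∉ cl η.toFinset h₁ ∧ h₀ ∉ cl η.toFinset h₁ ∧ Sep DX (cl η.toFinset h₁) c h₀} η) = (∑ η : BondConfig V, rcWeightW wX q ({h₀, h₁} : Set V) η * ind {η : BondConfig V | c ∉ cl η.toFinset h₀ ∧ h₁ ∉ cl η.toFinset h₀ ∧ h₁ ∉ cl η.toFinset c ∧ ¬ Sep DX (cl η.toFinset h₀) c h₁ ∧ Sep DX (cl η.toFinset h₁) c h₀} η) + (∑ η : BondConfig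 V, rcWeightW wX q ({h₀, h₁} : Set V) η * ind {η : BondConfig V | c ∉ cl η.toFinset h₀ ∧ h₁ ∉ cl η.toFinset h₀ ∧ h₁ ∉ cl η.toFinset c ∧ Sep DX (cl η.toFinset h₀) c h₁ ∧ Sep DX (cl η.toFinset h₁) c h₀} η) := by
  rw [← Finset.sum_add_distrib]
  refine Finset.sum_congr rfl fun η _ => ?_
  by_cases hη : η ⊆ ↑DX
  swap
  · rw [rcW_arm_zero wX hX' hη]; ring
  have hζ : η.toFinset ⊆ DX := fun e he => by rw [Set.mem_toFinset] at he; exact hη he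
  rw [← mul_add]
  congr 1
  refine ind_split η ?_ ?_ (fun h h' => h.2.2.2.1 h'.2.2.2.1) ?_
  · rintro ⟨c0, c1, c2, n0, n1⟩
    exact ⟨fun h => c2 (mem_cl_comm.1 h), fun h => c1 (mem_cl_comm.1 h), n1⟩
  · rintro ⟨c0, c1, c2, n0, n1⟩
    exact ⟨fun h => c2 (mem_cl_comm.1 h), fun h => c1 (mem_cl_comm.1 h), n1⟩
  · rintro ⟨d1, d0, n1⟩
    have c1 : h₁ ∉ cl η.toFinset h₀ := fun h => d0 (mem_cl_comm.1 h)
    have c2 : h₁ ∉ cl η.toFinset c := fun h => d1 (mem_cl_comm.1 h)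
    have c0 : c ∉ cl η.toFinset h₀ := fun hc =>
      (show ¬ Sep DX (cl η.toFinset h₁) c h₀ from by
        unfold RefinedRowR3.Sep; rw [not_not]
        exact mem_cl_sdiff_touch hζ (fun t ht htU => d1 (mem_cl_trans htU (mem_cl_comm.1 ht))) (mem_cl_comm.1 hc)) n1
    by_cases n0 : Sep DX (cl η.toFinset h₀) c h₁
    · exact Or.inr ⟨c0, c1, c2, n0, n1⟩
    · exact Or.inl ⟨c0, c1, c2, n0, n1⟩

end Main

end HubPairTerm

end Summit.CriticalPhenomena.PercolationContinuityZ3.Theorems
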